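import Summits.KontsevichZagierPeriods.KontsevichZagierPeriods.Theorems.RootDecompRelativeModAbsoluteRegFoldingDegOneP09

/-!
# `RegFoldingDegOne` (route `RootDecompRelativeModAbsolute`, support item stmt-KontsevichZagierPeriods-30571) — PROVED · part 10/14

Cell `decomp-kz`, lens 3 (decomp-kz-lens-3 g9): `regFoldingDegOne_holds :
Theses.RootDecompRelativeModAbsolute.RegFoldingDegOne` BY NAME (in part 14/14) — every Kontsevich–Zagier
integral representation on `ℝ²` whose integrand is a quotient `p/q` of `ℚ`-polynomials with `deg_t q ≤ 1`,
`q ≠ 0` on the domain, is equivalent in `KZ.relations` to `[g] + Σᵢ [Uᵢ]`, the `Uᵢ` honest 2-cells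
`[g.domain × (0,1), hᵢ(x) θ^{Mᵢ}/(1 + θ^{eᵢ} κᵢ(x))]` (unfolded REGULARISED log/arctan monomials), with the
fibre integrals matching a.e.  Architecture: §1–§2 regularised terms `RTerm`, `RegFolding d`; §7 a.e.-congruence;
§8 gluing (`FoldsTo`); §9 one-band toolkit; §P analytic core (kernel independence); §10 cylinders; §11 affine band
chart; §13 `RegFolding 1` from a CAD band cover a.e. + vanishing on unbounded bands; last part: the edge to the born
item text and `regFoldingDegOne_holds`.

Source: `HOME/decomp-kz-lens-3/g9/landing/RootDecompRelativeModAbsoluteRegFoldingDegOne.lean` sha256 60038aa44a5f6303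
(4275 l; critic decomp-kz-crit-1 g2 CLEARED/kernel-confirmed 2026-08-30T09:41:19Z, std axioms), split mechanically
into 14 modules ≤ 400 lines by the landing seat decomp-kz-census-1 g7 (contexts re-opened per part; generic docstrings
added where the source had none; parts 1–13 do not import the route file).  No `sorry`; standard axioms.
References: [cite: KontsevichZagier2001, §1.2]; Basu–Pollack–Roy 2006 Def. 5.1 / Cor. 5.7; Bochnak–Coste–Roy 1998 §2.9.
-/

noncomputable section

open Set MeasureTheory Filter Topology
open scoped BigOperators
open Literature.NumberTheory.Transcendental Literature.ModelTheory.ExponentialFields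

namespace Summit.KontsevichZagierPeriods.RootDecompRelativeModAbsolute.Rung30571

-- PRIVATE copy (landed twin in farm-unbuilt HyperbolicBloch module; dedup.landed): isSemialgebraicFunOn_finset_sum
/-- Finite sums of `ℚ`-semialgebraic functions are `ℚ`-semialgebraic. [BCR 1998, Prop. 2.2.6] -/
private theorem isSemialgebraicFunOn_finset_sum {n : ℕ} {s : Set (Fin n → ℝ)} (hs : IsSemialgebraic ℚ s)
    {ι : Type*} (I : Finset ι) {f : ι → (Fin n → ℝ) → ℝ}
    (hf : ∀ i ∈ I, IsSemialgebraicFunOn ℚ s (f i)) :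
    IsSemialgebraicFunOn ℚ s (fun x => ∑ i ∈ I, f i x) := by
  classical
  induction I using Finset.induction_on with
  | empty => exact (isSemialgebraicFunOn_ratCast hs 0).congr fun x _ => by simp
  | insert a I ha ih =>
    have h1 : IsSemialgebraicFunOn ℚ s (f a) := hf a (Finset.mem_insert_self a I)
    have h2 := ih fun i hi => hf i (Finset.mem_insert_of_mem hi)
    refine (IsSemialgebraicFunOn.add_holds h1 h2).congr fun x _ => ?_
    simp only [Pi.add_apply, Finset.sum_insert ha]

namespace RegularisedLogLayer

section DegOneAlgebra

/-- Taylor-form quotient coefficient `sₖ = Σ_{i ≤ k} cᵢ (−κ)^{k−i}`. -/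
def tayCoeff (n : ℕ) (c : ℕ → ℝ) (κ : ℝ) (k : ℕ) : ℝ :=
  ∑ i ∈ Finset.range (n + 1), if i ≤ k then c i * (-κ) ^ (k - i) else 0

/-- Taylor-form remainder `R = Σᵢ cᵢ (−κ)^{n+1−i}`. -/
def tayRem (n : ℕ) (c : ℕ → ℝ) (κ : ℝ) : ℝ :=
  ∑ i ∈ Finset.range (n + 1), c i * (-κ) ^ (n + 1 - i)

/-- **Taylor division** (no division by `κ`):
`N(θ)/(1+κθ) = Σ_{k≤n} sₖ θ^k + R·θ^{n+1}/(1+κθ)`. [elementary algebra] -/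
theorem taylor_div (n : ℕ) (c : ℕ → ℝ) (κ θ : ℝ) (h : 1 + κ * θ ≠ 0) :
    (∑ i ∈ Finset.range (n + 1), c i * θ ^ i) / (1 + κ * θ) =
      ∑ k ∈ Finset.range (n + 1), tayCoeff n c κ k * θ ^ k +
        tayRem n c κ * θ ^ (n + 1) / (1 + κ * θ) := by
  have inner : ∀ i ∈ Finset.range (n + 1),
      (1 + κ * θ) * ∑ k ∈ Finset.range (n + 1),
          (if i ≤ k then c i * (-κ) ^ (k - i) else 0) * θ ^ k =
        c i * θ ^ i - c i * (-κ) ^ (n + 1 - i) * θ ^ (n + 1) := by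
    intro i hi
    have hi' : i ≤ n := by simpa [Finset.mem_range, Nat.lt_succ_iff] using hi
    have e1 : ∑ k ∈ Finset.range (n + 1), (if i ≤ k then c i * (-κ) ^ (k - i) else 0) * θ ^ k =
        c i * θ ^ i * ∑ j ∈ Finset.range (n + 1 - i), (-κ * θ) ^ j := by
      have e2 : ∑ k ∈ Finset.range (n + 1), (if i ≤ k then c i * (-κ) ^ (k - i) else 0) * θ ^ k =
          ∑ k ∈ Finset.Ico i (n + 1), c i * (-κ) ^ (k - i) * θ ^ k := by
        simp only [ite_mul, zero_mul]
        rw [← Finset.sum_filter]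
        congr 1
        ext k
        simp only [Finset.mem_filter, Finset.mem_range, Finset.mem_Ico]
        omega
      rw [e2, Finset.sum_Ico_eq_sum_range, Finset.mul_sum]
      refine Finset.sum_congr rfl fun j _ => ?_
      rw [add_tsub_cancel_left, pow_add, mul_pow]
      ring
    calc (1 + κ * θ) * ∑ k ∈ Finset.range (n + 1),
          (if i ≤ k then c i * (-κ) ^ (k - i) else 0) * θ ^ k
        = c i * θ ^ i * ((1 - (-κ * θ)) * ∑ j ∈ Finset.range (n + 1 - i), (-κ * θ) ^ j) := by
          rw [e1]; ring
      _ = c i * θ ^ i * (1 - (-κ * θ) ^ (n + 1 - i)) := by rw [mul_neg_geom_sum]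
      _ = c i * θ ^ i - c i * (-κ) ^ (n + 1 - i) * θ ^ (n + 1) := by
          have hp : θ ^ (n + 1) = θ ^ i * θ ^ (n + 1 - i) := by
            rw [← pow_add]; congr 1; omega
          rw [hp, mul_pow]
          ring
  have key : (1 + κ * θ) * ∑ k ∈ Finset.range (n + 1), tayCoeff n c κ k * θ ^ k =
      ∑ i ∈ Finset.range (n + 1), c i * θ ^ i - tayRem n c κ * θ ^ (n + 1) := by
    calc (1 + κ * θ) * ∑ k ∈ Finset.range (n + 1), tayCoeff n c κ k * θ ^ k
        = ∑ i ∈ Finset.range (n + 1), (1 + κ * θ) * ∑ k ∈ Finset.range (n + 1),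
            (if i ≤ k then c i * (-κ) ^ (k - i) else 0) * θ ^ k := by
          simp only [tayCoeff, Finset.sum_mul, Finset.mul_sum]
          exact Finset.sum_comm
      _ = ∑ i ∈ Finset.range (n + 1), (c i * θ ^ i - c i * (-κ) ^ (n + 1 - i) * θ ^ (n + 1)) :=
          Finset.sum_congr rfl inner
      _ = ∑ i ∈ Finset.range (n + 1), c i * θ ^ i - tayRem n c κ * θ ^ (n + 1) := by
          rw [Finset.sum_sub_distrib, tayRem, Finset.sum_mul]
  have hS : ∑ k ∈ Finset.range (n + 1), tayCoeff n c κ k * θ ^ k =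
      (∑ i ∈ Finset.range (n + 1), c i * θ ^ i - tayRem n c κ * θ ^ (n + 1)) / (1 + κ * θ) := by
    rw [eq_div_iff h, mul_comm]
    exact key
  rw [hS, ← add_div, sub_add_cancel]

/-- Horner-form quotient coefficient `wⱼ = Σ_{i > j} cᵢ κ⁻¹ (−κ⁻¹)^{i−1−j}` (division from the top,
`κ ≠ 0`). -/
def horCoeff (n : ℕ) (c : ℕ → ℝ) (κ : ℝ) (j : ℕ) : ℝ :=
  ∑ i ∈ Finset.range (n + 1), if j < i then c i * κ⁻¹ * (-κ⁻¹) ^ (i - 1 - j) else 0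

/-- Horner-form remainder `N(−1/κ) = Σᵢ cᵢ (−κ⁻¹)ⁱ`. -/
def horRem (n : ℕ) (c : ℕ → ℝ) (κ : ℝ) : ℝ :=
  ∑ i ∈ Finset.range (n + 1), c i * (-κ⁻¹) ^ i

/-- **Horner division** (`κ ≠ 0`): `N(θ)/(1+κθ) = Σ_{j≤n} wⱼ θ^j + N(−1/κ)/(1+κθ)`.
[elementary algebra] -/
theorem horner_div (n : ℕ) (c : ℕ → ℝ) {κ θ : ℝ} (hκ : κ ≠ 0) (h : 1 + κ * θ ≠ 0) :
    (∑ i ∈ Finset.range (n + 1), c i * θ ^ i) / (1 + κ * θ) =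
      ∑ j ∈ Finset.range (n + 1), horCoeff n c κ j * θ ^ j + horRem n c κ / (1 + κ * θ) := by
  set ρ : ℝ := -κ⁻¹ with hρ
  have hfac : 1 + κ * θ = κ * (θ - ρ) := by
    rw [hρ]; field_simp; ring
  have mono : ∀ i : ℕ, c i * θ ^ i - c i * ρ ^ i =
      (1 + κ * θ) * ∑ j ∈ Finset.range i, c i * κ⁻¹ * ρ ^ (i - 1 - j) * θ ^ j := by
    intro i
    calc c i * θ ^ i - c i * ρ ^ i
        = c i * ((∑ j ∈ Finset.range i, θ ^ j * ρ ^ (i - 1 - j)) * (θ - ρ)) := by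
          rw [geom_sum₂_mul]; ring
      _ = (1 + κ * θ) * ∑ j ∈ Finset.range i, c i * κ⁻¹ * ρ ^ (i - 1 - j) * θ ^ j := by
          rw [hfac]
          simp only [Finset.mul_sum, Finset.sum_mul]
          refine Finset.sum_congr rfl fun j _ => ?_
          field_simp
  have key : ∑ i ∈ Finset.range (n + 1), c i * θ ^ i - horRem n c κ =
      (1 + κ * θ) * ∑ j ∈ Finset.range (n + 1), horCoeff n c κ j * θ ^ j := by
    have e : ∀ i ∈ Finset.range (n + 1),
        ∑ j ∈ Finset.range i, c i * κ⁻¹ * ρ ^ (i - 1 - j) * θ ^ j =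
          ∑ j ∈ Finset.range (n + 1),
            if j < i then c i * κ⁻¹ * ρ ^ (i - 1 - j) * θ ^ j else 0 := by
      intro i hi
      rw [Finset.mem_range] at hi
      rw [← Finset.sum_filter]
      congr 1
      ext j
      simp only [Finset.mem_filter, Finset.mem_range]
      omega
    calc ∑ i ∈ Finset.range (n + 1), c i * θ ^ i - horRem n c κ
        = ∑ i ∈ Finset.range (n + 1), (c i * θ ^ i - c i * ρ ^ i) := by
          rw [horRem, ← Finset.sum_sub_distrib]
      _ = ∑ i ∈ Finset.range (n + 1), (1 + κ * θ) *
            ∑ j ∈ Finset.range i, c i * κ⁻¹ * ρ ^ (i - 1 - j) * θ ^ j :=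
          Finset.sum_congr rfl fun i _ => mono i
      _ = (1 + κ * θ) * ∑ i ∈ Finset.range (n + 1), ∑ j ∈ Finset.range (n + 1),
            (if j < i then c i * κ⁻¹ * ρ ^ (i - 1 - j) * θ ^ j else 0) := by
          rw [Finset.mul_sum]
          exact Finset.sum_congr rfl fun i hi => by rw [e i hi]
      _ = (1 + κ * θ) * ∑ j ∈ Finset.range (n + 1), horCoeff n c κ j * θ ^ j := by
          rw [Finset.sum_comm]
          congr 1
          refine Finset.sum_congr rfl fun j _ => ?_
          rw [horCoeff, Finset.sum_mul]
          refine Finset.sum_congr rfl fun i _ => ?_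
          split_ifs <;> simp [hρ]
  have hW : ∑ j ∈ Finset.range (n + 1), horCoeff n c κ j * θ ^ j =
      (∑ i ∈ Finset.range (n + 1), c i * θ ^ i - horRem n c κ) / (1 + κ * θ) := by
    rw [eq_div_iff h, mul_comm]
    exact key.symm
  rw [hW, ← add_div, sub_add_cancel]

/-- On `A ≠ 0`: `N/(A + Bθ)` in Taylor form with `κ = B/A`, order `n + 1` kernel. -/
theorem ratDegOne_taylor_form (n : ℕ) (c : ℕ → ℝ) {A B θ : ℝ} (hA : A ≠ 0)
    (h : A + B * θ ≠ 0) :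
    (∑ i ∈ Finset.range (n + 1), c i * θ ^ i) / (A + B * θ) =
      ∑ k ∈ Finset.range (n + 1), (tayCoeff n c (B / A) k / A) * θ ^ k +
        (tayRem n c (B / A) / A) * kernel (n + 1) 1 (B / A) θ := by
  have hfac : A + B * θ = (1 + B / A * θ) * A := by field_simp
  have h1 : 1 + B / A * θ ≠ 0 := by
    intro h0; exact h (by rw [hfac, h0, zero_mul])
  rw [hfac, ← div_div, taylor_div n c (B / A) θ h1, add_div, Finset.sum_div, kernel, pow_one]
  congr 1
  · exact Finset.sum_congr rfl fun k _ => by ring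
  · rw [mul_comm θ (B / A)]
    ring

/-- On `A ≠ 0`, `B ≠ 0`: `N/(A + Bθ)` in Horner form with `κ = B/A`, order `0` kernel. -/
theorem ratDegOne_horner_form (n : ℕ) (c : ℕ → ℝ) {A B θ : ℝ} (hA : A ≠ 0) (hB : B ≠ 0)
    (h : A + B * θ ≠ 0) :
    (∑ i ∈ Finset.range (n + 1), c i * θ ^ i) / (A + B * θ) =
      ∑ j ∈ Finset.range (n + 1), (horCoeff n c (B / A) j / A) * θ ^ j +
        (horRem n c (B / A) / A) * kernel 0 1 (B / A) θ := by
  have hfac : A + B * θ = (1 + B / A * θ) * A := by field_simp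
  have h1 : 1 + B / A * θ ≠ 0 := by
    intro h0; exact h (by rw [hfac, h0, zero_mul])
  rw [hfac, ← div_div, horner_div n c (div_ne_zero hB hA) h1, add_div, Finset.sum_div, kernel,
    pow_zero, pow_one]
  congr 1
  · exact Finset.sum_congr rfl fun k _ => by ring
  · rw [mul_comm θ (B / A)]
    ring

/-- On `A = 0` (so `B ≠ 0`): pole at `θ = 0`,
`N/(Bθ) = Σ_{j<n} (c_{j+1}/B) θ^j + (c₀/B)·θ⁻¹`. -/
theorem ratDegOne_pole_zero_form (n : ℕ) (c : ℕ → ℝ) {A B θ : ℝ} (hA : A = 0) (hB : B ≠ 0)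
    (hθ : θ ≠ 0) :
    (∑ i ∈ Finset.range (n + 1), c i * θ ^ i) / (A + B * θ) =
      ∑ j ∈ Finset.range n, (c (j + 1) / B) * θ ^ j + (c 0 / B) * θ⁻¹ := by
  rw [hA, zero_add, Finset.sum_range_succ', add_div, Finset.sum_div]
  congr 1
  · refine Finset.sum_congr rfl fun j _ => ?_
    rw [pow_succ]
    field_simp
  · rw [pow_zero, mul_one]
    field_simp

/-- On `A ≠ 0`, `A + B = 0`: pole at `θ = 1`, Horner form with `κ = −1`,
`N/(A − Aθ) = Σ_j (wⱼ/A) θ^j + (N(1)/A)·(1−θ)⁻¹`. -/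
theorem ratDegOne_pole_one_form (n : ℕ) (c : ℕ → ℝ) {A B θ : ℝ} (hA : A ≠ 0)
    (hAB : A + B = 0) (hθ : θ ≠ 1) :
    (∑ i ∈ Finset.range (n + 1), c i * θ ^ i) / (A + B * θ) =
      ∑ j ∈ Finset.range (n + 1), (horCoeff n c (-1) j / A) * θ ^ j +
        (horRem n c (-1) / A) * (1 - θ)⁻¹ := by
  have hB : B = -A := by linarith
  have hκ : B / A = -1 := by rw [hB, neg_div, div_self hA]
  have h : A + B * θ ≠ 0 := by
    rw [hB]
    intro h0
    have h1 : A * (1 - θ) = 0 := by linarith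
    rcases mul_eq_zero.1 h1 with h2 | h2
    · exact hA h2
    · exact hθ (by linarith)
  rw [ratDegOne_horner_form n c hA (by rw [hB]; exact neg_ne_zero.2 hA) h, hκ]
  congr 1
  simp only [kernel, pow_zero, pow_one]
  rw [show (1 : ℝ) + θ * (-1) = 1 - θ by ring, one_div]

/-- `A ≠ 0`, `A + B ≠ 0` and `A + Bθ ≠ 0` on `(0,1)` force `κ = B/A > −1`. -/
theorem neg_one_lt_ratio {A B : ℝ} (hA : A ≠ 0) (hAB : A + B ≠ 0)
    (hne : ∀ θ ∈ Ioo (0 : ℝ) 1, A + B * θ ≠ 0) : -1 < B / A := by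
  by_contra hle
  push Not at hle
  have hB : B = B / A * A := by field_simp
  have hκ1 : B / A ≠ -1 := by
    intro h1
    apply hAB
    rw [hB, h1]
    ring
  have hlt : B / A < -1 := lt_of_le_of_ne hle hκ1
  have hκ0 : B / A < 0 := by linarith
  have hθpos : 0 < -1 / (B / A) := div_pos_of_neg_of_neg (by norm_num) hκ0
  have hθlt : -1 / (B / A) < 1 := by rw [div_lt_one_of_neg hκ0]; linarith
  refine hne (-1 / (B / A)) ⟨hθpos, hθlt⟩ ?_
  have hκne : B / A ≠ 0 := hκ0.ne
  have h1 : B / A * (-1 / (B / A)) = -1 := by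
    generalize B / A = κ at hκne ⊢
    field_simp
  calc A + B * (-1 / (B / A)) = A + (B / A * A) * (-1 / (B / A)) := by rw [← hB]
    _ = A * (1 + B / A * (-1 / (B / A))) := by ring
    _ = 0 := by rw [h1]; ring

end DegOneAlgebra

section DegOnePieces

variable {b : ℕ}

/-! ### §10.3 Semialgebraicity of the quotient coefficients; termwise integrability (a.e. forms) -/

/-- `isSemialgebraicFunOn_tayCoeff`: auxiliary theorem of the `RegFoldingDegOne` (stmt-30571) development — see the module docstring; statement and proof verbatim from the lens-3 g9 landing file. -/
theorem isSemialgebraicFunOn_tayCoeff {S : Set (Fin b → ℝ)} (hS : IsSemialgebraic ℚ S) (n : ℕ)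
    {c : ℕ → (Fin b → ℝ) → ℝ} (hc : ∀ i, IsSemialgebraicFunOn ℚ S (c i))
    {κ : (Fin b → ℝ) → ℝ} (hκ : IsSemialgebraicFunOn ℚ S κ) (k : ℕ) :
    IsSemialgebraicFunOn ℚ S (fun x => tayCoeff n (fun i => c i x) (κ x) k) := by
  unfold tayCoeff
  refine isSemialgebraicFunOn_finset_sum hS _ fun i _ => ?_
  by_cases hik : i ≤ k
  · simp only [if_pos hik]
    exact IsSemialgebraicFunOn.mul_holds (hc i)
      (isSemialgebraicFunOn_pow hS (isSemialgebraicFunOn_neg' hS hκ) (k - i))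
  · simp only [if_neg hik]
    exact (isSemialgebraicFunOn_ratCast hS 0).congr fun x _ => by simp

/-- `isSemialgebraicFunOn_tayRem`: auxiliary theorem of the `RegFoldingDegOne` (stmt-30571) development — see the module docstring; statement and proof verbatim from the lens-3 g9 landing file. -/
theorem isSemialgebraicFunOn_tayRem {S : Set (Fin b → ℝ)} (hS : IsSemialgebraic ℚ S) (n : ℕ)
    {c : ℕ → (Fin b → ℝ) → ℝ} (hc : ∀ i, IsSemialgebraicFunOn ℚ S (c i))
    {κ : (Fin b → ℝ) → ℝ} (hκ : IsSemialgebraicFunOn ℚ S κ) :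
    IsSemialgebraicFunOn ℚ S (fun x => tayRem n (fun i => c i x) (κ x)) := by
  unfold tayRem
  exact isSemialgebraicFunOn_finset_sum hS _ fun i _ =>
    IsSemialgebraicFunOn.mul_holds (hc i)
      (isSemialgebraicFunOn_pow hS (isSemialgebraicFunOn_neg' hS hκ) (n + 1 - i))

/-- `isSemialgebraicFunOn_horCoeff`: auxiliary theorem of the `RegFoldingDegOne` (stmt-30571) development — see the module docstring; statement and proof verbatim from the lens-3 g9 landing file. -/
theorem isSemialgebraicFunOn_horCoeff {S : Set (Fin b → ℝ)} (hS : IsSemialgebraic ℚ S) (n : ℕ)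
    {c : ℕ → (Fin b → ℝ) → ℝ} (hc : ∀ i, IsSemialgebraicFunOn ℚ S (c i))
    {κ : (Fin b → ℝ) → ℝ} (hκ : IsSemialgebraicFunOn ℚ S κ) (hκ0 : ∀ x ∈ S, κ x ≠ 0) (j : ℕ) :
    IsSemialgebraicFunOn ℚ S (fun x => horCoeff n (fun i => c i x) (κ x) j) := by
  unfold horCoeff
  have hinv : IsSemialgebraicFunOn ℚ S (fun x => (κ x)⁻¹) := hκ.inv hκ0
  refine isSemialgebraicFunOn_finset_sum hS _ fun i _ => ?_
  by_cases hji : j < i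
  · simp only [if_pos hji]
    exact IsSemialgebraicFunOn.mul_holds (IsSemialgebraicFunOn.mul_holds (hc i) hinv)
      (isSemialgebraicFunOn_pow hS (isSemialgebraicFunOn_neg' hS hinv) (i - 1 - j))
  · simp only [if_neg hji]
    exact (isSemialgebraicFunOn_ratCast hS 0).congr fun x _ => by simp

/-- `isSemialgebraicFunOn_horRem`: auxiliary theorem of the `RegFoldingDegOne` (stmt-30571) development — see the module docstring; statement and proof verbatim from the lens-3 g9 landing file. -/
theorem isSemialgebraicFunOn_horRem {S : Set (Fin b → ℝ)} (hS : IsSemialgebraic ℚ S) (n : ℕ)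
    {c : ℕ → (Fin b → ℝ) → ℝ} (hc : ∀ i, IsSemialgebraicFunOn ℚ S (c i))
    {κ : (Fin b → ℝ) → ℝ} (hκ : IsSemialgebraicFunOn ℚ S κ) (hκ0 : ∀ x ∈ S, κ x ≠ 0) :
    IsSemialgebraicFunOn ℚ S (fun x => horRem n (fun i => c i x) (κ x)) := by
  unfold horRem
  exact isSemialgebraicFunOn_finset_sum hS _ fun i _ =>
    IsSemialgebraicFunOn.mul_holds (hc i)
      (isSemialgebraicFunOn_pow hS (isSemialgebraicFunOn_neg' hS (hκ.inv hκ0)) i)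

/-- **Termwise integrability, Taylor regime** — a.e. form of `Plan.integrable_coeffs_taylor`
for an arbitrary measure (used with `volume.restrict P`). -/
theorem integrable_coeffs_taylor_ae {α : Type*} [MeasurableSpace α] {μ : Measure α} {m : ℕ}
    (a : α → Fin (m + 1) → ℝ) (bb κ : α → ℝ)
    (ha : ∀ k, AEStronglyMeasurable (fun x => a x k) μ) {η₁ c : ℝ} (hc : 0 < c)
    (hT : ∀ κ' : ℝ, |κ'| ≤ η₁ → ∀ (a' : Fin (m + 1) → ℝ) (b' : ℝ),
      c * (∑ k, |a' k| + |b'|) ≤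
        ∫ θ in Ioo (0 : ℝ) 1, |∑ k : Fin (m + 1), a' k * θ ^ (k : ℕ) + b' * θ ^ (m + 1) / (1 + κ' * θ)|)
    (hκ : ∀ᵐ x ∂μ, |κ x| ≤ η₁)
    (hA : Integrable (fun x => ∫ θ in Ioo (0 : ℝ) 1,
      |∑ k : Fin (m + 1), a x k * θ ^ (k : ℕ) + bb x * θ ^ (m + 1) / (1 + κ x * θ)|) μ) :
    ∀ k, Integrable (fun x => a x k) μ := by
  intro k
  have hsum : ∀ x, |a x k| ≤ ∑ j, |a x j| := fun x =>
    Finset.single_le_sum (f := fun j => |a x j|) (fun j _ => abs_nonneg _) (Finset.mem_univ k)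
  refine Integrable.mono' (hA.div_const c) (ha k) ?_
  filter_upwards [hκ] with x hx
  rw [Real.norm_eq_abs, le_div_iff₀ hc]
  have h1 := hT (κ x) hx (a x) (bb x)
  have h2 := hsum x
  nlinarith [abs_nonneg (bb x)]

/-- **Termwise integrability, away regime** — a.e. form of `Plan.integrable_coeffs_away`. -/
theorem integrable_coeffs_away_ae {α : Type*} [MeasurableSpace α] {μ : Measure α} {m : ℕ}
    {η : ℝ} (hη : 0 < η) (a : α → Fin (m + 1) → ℝ) (bb κ : α → ℝ)
    (ha : ∀ k, AEStronglyMeasurable (fun x => a x k) μ)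
    (hκ : ∀ᵐ x ∂μ, -1 < κ x ∧ η ≤ |κ x|)
    (hA : Integrable (fun x => ∫ θ in Ioo (0 : ℝ) 1,
      |∑ k : Fin (m + 1), a x k * θ ^ (k : ℕ) + bb x / (1 + κ x * θ)|) μ) :
    ∀ k, Integrable (fun x => a x k) μ := by
  obtain ⟨c, hc, h⟩ := Plan.kernelIndependenceAway m hη
  intro k
  have hsum : ∀ x, |a x k| ≤ ∑ j, |a x j| := fun x =>
    Finset.single_le_sum (f := fun j => |a x j|) (fun j _ => abs_nonneg _) (Finset.mem_univ k)
  refine Integrable.mono' (hA.div_const c) (ha k) ?_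
  filter_upwards [hκ] with x hx
  rw [Real.norm_eq_abs, le_div_iff₀ hc]
  have h1 := h (κ x) hx.1 hx.2 (a x) (bb x)
  have h2 := hsum x
  have h3 : 0 ≤ |bb x| * Plan.ell0 (κ x) := mul_nonneg (abs_nonneg _) (Plan.ell0_nonneg hx.1)
  nlinarith

/-! ### §10.4 The four pieces -/

end DegOnePieces

end RegularisedLogLayer

end Summit.KontsevichZagierPeriods.RootDecompRelativeModAbsolute.Rung30571

end
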